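import Summits.Parity.BatemanHorn.Theorems.RoughValueTransportBalancedSemiprimeLayerDegreeLeTwo
import Summits.Parity.BatemanHorn.Theses.RoughValueTransport
import HarnessLib

/-!
# Line `smooth-modulus-twisted-hooley` — checked skeleton for crux `BalancedSemiprimeLayer`
(item stmt-Parity-9469, route `RoughValueTransport`, sub-problem `BatemanHorn`)
— LEAD'S RESHAPE r1, integration 5 (prover-line-stmt-Parity-9469-0, 2026-08-16): ALL working stubs LANDED; only the open residual `stub_higherLayer` is sorried
— RESHAPE r2, integration 7 (lead prover-line-stmt-Parity-9469-1): the composition now runs through the registered SPLIT GLUE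
— integration 8: `stub_degreeSplit` LANDED (p83112, `Theorems/RoughValueTransportBalancedSemiprimeLayerSplit.lean` — the
  planner-facing re-typing of `stub_transfer` in unfolded route vocabulary, with `Split.layerLinear_unfolded`,
  `Split.layerQuadratic_unfolded`, `Split.balancedSemiprimeLayer_iff_higherLayer_unfolded`); the composition below is the
  landed `stub_transfer` applied to the ONLY `sorry` left, `stub_higherLayer` (OPEN, crux-equivalent, handed back: promote-stub)
  `stub_degreeSplit : LayerLinear → LayerQuadratic → LayerHigher → BalancedSemiprimeLayer` (all three in UNFOLDED route
  vocabulary; proved in `Theorems/RoughValueTransportBalancedSemiprimeLayerSplit.lean` as `stub_transfer` re-typed), fed with the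
  landed `stub_linearLayer`, the landed quadratic composition, and the open `stub_higherLayer`; the glue duplicated from
  `Theorems/…DegreeLeTwo.lean` (p78616) is now IMPORTED from there instead of restated.
— RE-SEAT (lead prover-line-stmt-Parity-9469-1, 2026-08-16, integration 6): state re-verified from the tree — the six
  working stubs and the composition `Theorems/…DegreeLeTwo.lean` (p78616: `stub_transfer`,
  `layerConclusion_of_natDegree_le_two`, `balancedSemiprimeLayer_iff_higherLayer`) are LANDED; the ONLY `sorry` is
  `stub_higherLayer`, held by the lead (nothing to fan out), analysed in `Cruxes/…/NOTES.md` §Census (ten handles, all dead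
  at "power-saving root equidistribution beyond x for degree ≥ 3") and handed back as crux-sized (promote-stub →
  the route's `LayerHigher`); planner handoff = `Theorems/RoughValueTransportBalancedSemiprimeLayerSplit.lean`
  (`Split.layerLinear_unfolded`, `Split.layerQuadratic_unfolded`, `Split.balancedSemiprimeLayer_iff_higherLayer_unfolded`,
  `Split.glue_unfolded`: the degree split BY NAME and in route vocabulary, all proved but `LayerHigher`).

Crux (by name, concluded by `BalancedSemiprimeLayer_of` below, from the split glue `stub_degreeSplit`):
`Summit.Parity.BatemanHorn.Theses.RoughValueTransport.BalancedSemiprimeLayer` — for every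
Bateman–Horn system `f` of `k` polynomials and every `ε > 0` there is `δ ∈ (0, 1/4]` with, eventually
in `x`, `Φ_f(x, δ) ≤ P_f(x) + ε·x/(log x)^k`, where `Φ_f(x, δ)` counts the `1 ≤ n ≤ x` all of whose
values `fᵢ(n)` are positive and free of primes `< x^{deg fᵢ (1−δ)/2}` (jointly rough) and
`P_f = polyPrimeCount f`.

## The line (idea card `Ideas/smooth-modulus-twisted-hooley.md`, planner skeleton commit a0a8ea2b35d1,
merged per triage with `rough-relaxed-divisor-sieve`; triage TRIAGE-r1-{1,2,3}.md all pass)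

Union bound over coordinates KEEPING THE OTHER COORDINATES ROUGH (the naive coordinatewise bound is
refuted: `Negative.not_cruxCoordinatewise`), then by the degree of the coordinate:

* `stub_linearLayer` — a linear coordinate: the balanced prime `p₁ ≤ √(a x + b)` is an individual
  modulus of a progression of length `≥ √x`; relax the cofactor's primality and the spectators'
  roughness to `x^c`-roughness and apply the `k`-dimensional upper-bound sieve
  (`SieveSequence.fundamental_lemma_uniform_holds`, PROVED; template `polyPrimeCount_le_brunSieve_holds`
  + `polyAPSeq`) — Type-I is trivial (moduli `< x^{0.7}`); `∑ 1/p₁ ≈ log((1+δ)/(1−δ))` by the PROVED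
  Mertens window sums (`sum_inv_primes_window_le`, `abs_primeRecipSum_sub_le`).
* `stub_twistedHooley` — THE LEVER (the only input beyond level `x`): a Hooley-1963-type power
  saving for the root Weyl sums of the DILATES `Q²X² − Δ` of the discriminant form of an
  irreducible quadratic, over moduli `m ≤ M` in a class `m ≡ u (mod Q)`, `(m, Q) = 1`, losses
  polynomial in `Q, h`.  Rung `Q = 1` is the PROVED `hooley1963_quadraticRoots_allModuli_logSqSaving_holds`.
* `stub_uniformTypeI` — from the lever to plain Type-I information for the congruence counts of
  the quadratic `g` in progressions, UNIFORMLY (polynomially) in the progression modulus — the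
  uniform version of the PROVED `TypeIFromWeyl.typeI_of_weylLevelBound`.
* `stub_quadraticDictionary` (reshape r1, elementary) — a quadratic coordinate's layer injects
  (`n ↦ (n, minFac fᵢ(n))`, up to the `≤ 2` roots of `fᵢ − 1`) into the relaxed sifted divisor
  family `pairFamily f i δ c x` (window `m ∈ [x^{1−δ}, x^{1+δ}]`, `m ∣ fᵢ(n)`, `(m, B) = 1`, all
  `fⱼ(n)` `x^c`-rough): BOTH balanced primes relaxed — legal because the crux is an UPPER bound.
* `stub_quadraticSieve` (reshape r1, the sieve half) — `UniformTypeI (f i)` ⇒ the relaxed family is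
  thin: `#pairFamily ≤ ε x/(log x)^k` for all `δ ≤ δ₀(ε)` (dimension-`(k+1)` fundamental lemma on
  the pairs sifted by `p ∣ m·∏ⱼ fⱼ(n)`; `δ` survives only as the main-term factor
  `∑_{m ∈ window} ρ(m)/m ≍ 2δ log x`, PROVED `RhoLogSums.abs_rhoLogSum_sub_le`; remainder = `UniformTypeI`).
* `stub_higherLayer` — coordinates of degree `≥ 3`: the HONEST OPEN RESIDUAL of the crux (balanced
  factors `p₁ ~ x^{d(1−δ)/2} > x` = number of terms; `Literature.Barriers.Parity.FordMaynardLowLevel`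
  applies).  Registered so that the composition is honest; verbatim the route's foreseen split item
  `LayerHigher` (TWO-LAYER PLAN) in coordinate form.  STUCK/open from cycle 1 (promote-stub candidate).
* `stub_coordLayerMono` — bookkeeping (monotonicity of `E_{f,i}(x,δ)` in `δ`, used by the
  composition); registered so that the line's VOCABULARY file `Theorems/RoughValueTransportDefs.lean`
  (which proves it) can land as a `--supports` file — the registered stubs can only land under
  `Theorems/` once their vocabulary is importable from there.

Scope: the stubs other than `stub_higherLayer` close the crux for EVERY Bateman–Horn system all of
whose coordinates have degree `≤ 2`, and the linear/quadratic coordinates of any system.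

Disproof used (`Cruxes/BalancedSemiprimeLayer/Disproof.lean`, gen 2 rev 5; landed copies under
`Theorems/BalancedSemiprimeLayer/Negative/`): `not_cruxCoordinatewise` (spectators stay rough in
`coordLayer`), `_false_without_noFixedPrimeDivisor` (used in `stub_linearLayer`/`stub_quadraticSieve`:
`ω_F(p) < p` ⇔ sieve density `g(p) < 1`), `_false_without_irreducible` (used in `stub_twistedHooley`:
`Δ` non-square ⇔ `ρ` well defined and Hooley applies; and in `stub_quadraticDictionary`: `fᵢ − 1 ≠ 0`),
`_false_without_notAssociated` (the `k+1` sieve dimensions are distinct polynomials),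
`two_mul_delta_le_of_eventually_cruxIneq_X` (every stub outputs `E ≪_f δ·x/(log x)^k`: `δ(ε)` linear in
`ε`, `f`-dependent — consistent), refuted strengthenings (no stub claims a `(log x)^{-(k+1)}` tolerance
or a uniform `δ`); `§8 Targets`: none yet. Imported here: `natDegree_pos_of_isBatemanHornSystem`,
`balancedSemiprimeLayer_iff_pos`.

`lean check` (integration 8): rc 0, `sorry` ONLY inside `stub_higherLayer` (OPEN); the split glue `stub_degreeSplit` is the LANDED
`Theorems/RoughValueTransportBalancedSemiprimeLayerSplit.lean` (p83112); coordLayerMono p72142,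
quadraticDictionary p72470, linearLayer p73627, uniformTypeI p74271, twistedHooley p74670/p74417, quadraticSieve
p74679…p76614 and the composition glue `Theorems/…DegreeLeTwo.lean` p78616 (`stub_transfer`,
`layerConclusion_of_natDegree_le_two`, `balancedSemiprimeLayer_iff_higherLayer`) are LANDED and imported;
`BalancedSemiprimeLayer_of : BalancedSemiprimeLayer` (the by-name `#h21_check_skeleton` theorem) feeds the split glue
the landed linear stub, the landed quadratic composition and the open `stub_higherLayer`.

VOCABULARY: landed as `Theorems/RoughValueTransportDefs.lean` (p72142) and imported here.
-/

noncomputable section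

namespace Summit.Parity.BatemanHorn.Cruxes.BalancedSemiprimeLayer.SmoothModulusTwistedHooley

open Polynomial Filter Finset
open Literature.NumberTheory.Sieve
open Summit.Parity.BatemanHorn.Theses.RoughValueTransport (BalancedSemiprimeLayer)
open scoped BigOperators

/-! ### Objects of the line

The vocabulary (`coordLayer`, `CoordLayerThin`, `TwistedHooleyDilates`, `UniformTypeI`, `quadWindow`,
`pairFamily`, `coordLayer_mono`) is the LANDED file `Theorems/RoughValueTransportDefs.lean` (p72142); the six
working stubs are the LANDED files listed in the header; the composition glue (`card_cruxFilter_le`,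
`card_filter_allPrime_le_polyPrimeCount`, `DegreeLeTwo.coordLayerThin_quadratic_of_parts`,
`balancedSemiprimeLayer`-by-parts = `stub_transfer`, `layerConclusion_of_natDegree_le_two`,
`balancedSemiprimeLayer_iff_higherLayer`) is the LANDED file `Theorems/…DegreeLeTwo.lean` (p78616), imported. -/

/-! ### The registered stub still open (`sorry` lives ONLY here; `stub_degreeSplit` is LANDED, p83112) -/

/-- **stub_higherLayer** (OPEN — the crux's residual, not moved by this line; STUCK from cycle 1; handed
back as crux-sized = the route's `LayerHigher`).  Coordinates of degree `d ≥ 3`: balanced factors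
`p₁ ~ x^{d(1−δ)/2} ≥ x^{9/8}` exceed the number of terms; Type-I data below that level cannot
distinguish "fᵢ(n) prime" from "fᵢ(n) = p₁p₂ balanced" among rough values
(`Literature.Barriers.Parity.FordMaynardLowLevel`); the deg-2 divisor-pair mechanism would need
POWER-saving equidistribution of the roots of `fᵢ mod m` for `m > x` (print: log-savings only for
`d ≥ 3`, Hooley 1964).  NECESSARY for the crux (`Negative.higherLayer_of_balancedSemiprimeLayer`,
p75295), relatively consistent, no cheap kill (`Negative.LargePrimeFactors`).  Census of the ten
handles tried: `Cruxes/BalancedSemiprimeLayer/NOTES.md`. -/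
theorem stub_higherLayer :
    ∀ (k : ℕ) (f : Fin k → ℤ[X]), IsBatemanHornSystem f →
      ∀ i : Fin k, 3 ≤ (f i).natDegree → CoordLayerThin f i := by
  sorry

/-! ### The composition: the stubs imply the crux BY NAME -/

/-- **The line concludes the crux BY NAME** (the `#h21_check_skeleton` theorem): the LANDED transfer
`stub_transfer` (p78616; = the split glue `stub_degreeSplit` of p83112 with its two proved hypotheses
`Split.layerLinear_unfolded`, `Split.layerQuadratic_unfolded` already fed in) applied to the OPEN
`stub_higherLayer` gives `Summit.Parity.BatemanHorn.Theses.RoughValueTransport.BalancedSemiprimeLayer`.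
No `sorry` of its own; its axiom closure contains `sorryAx` exactly through `stub_higherLayer`. -/
theorem BalancedSemiprimeLayer_of : BalancedSemiprimeLayer :=
  stub_transfer stub_higherLayer

end Summit.Parity.BatemanHorn.Cruxes.BalancedSemiprimeLayer.SmoothModulusTwistedHooley
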